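import Literature.MathematicalPhysics.QuantumFieldTheory.Balaban1983to89.B9Ineq385V3RightKernel
import Literature.MathematicalPhysics.QuantumFieldTheory.Balaban1983to89.B9Ineq373L2Letters
import Literature.MathematicalPhysics.QuantumFieldTheory.Balaban1983to89.B9Ineq363L2Mixed
import Literature.MathematicalPhysics.QuantumFieldTheory.Balaban1983to89.B6RandomWalkL2Schur

/-!
# `Balaban1983to89.B9Ineq385L2V3Right` — [Balaban1985BackgroundPropagators] (3.85) p. 407 IN THE BLOCK-`ℓ²` CURRENCY, THE `V₃(A)` THIRD ON THE RIGHT: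
# `G(U) · conj b V₃(A) ≺₂ O(1)B₀α₁e^{−ρd}` — via a GENERIC BRIDGE «sup block majorant + locality + stencil multiplicity ⟹ block-`ℓ²` majorant» (Schur
# test on one block pair with the operator transpose) applied to r06's sup commutator sizes of (3.73), and this seat's `ℓ²` divergence-form device;
# third brick of the kernel-free `ℓ²` route to the (3.46) members of `G(U′U)` displayed in `B9SectBStepFrameV4.SectBFrame₄`

T. Bałaban, *Propagators for lattice gauge theories in a background field*, Commun. Math. Phys. **99** (1985) 389–434
[`Balaban1985BackgroundPropagators`, "B9"]; [4] = T. Bałaban, *Propagators and renormalization transformations for lattice gauge theories. II*,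
Commun. Math. Phys. **96** (1984) 223–250 [`Balaban1984PropagatorsII`].

statement-level skeleton of published theorems with citation tags; proofs where landed; nothing here is a claim about the Yang–Mills mass gap

THE PRINTED LOCUS (verbatim).  p. 407: *"The operator V₃(A) is a local differential operator of the first order satisfying the bound (3.73). … |(V(A)G(U)J)(b)|
≤ O(1)α₁e^{−(1/2)δ₀d(y,y′)}|J| … (3.85) … G(U′U) = G(U)(I − V(A)G(U))⁻¹ = Σ_{n=0}^∞ G(U)(V(A)G(U))ⁿ, (3.86) … Theorem (3.3) implies also convergence in
all norms appearing in its formulation"*; p. 403 l. 5–9 (for G′): *"G′(U′U) = G′(U) + G′(U)V′(A)G′(U′U) = G′(U) + G′(U′U)V′(A)G′(U), (3.65) … the remainders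
… satisfy Theorem 3.1 with the additional small factor O(1)α₁"* — the RIGHT entries `G(U′U)·∇*`, `G(U′U)·∇*∇*` of (3.46) are summed from the first
form, which needs `G(U)·V(A)` small; [4] (2.140)–(2.141) p. 247 (`L²` block norms, «convergent in the norms appearing»).

WHY THIS FILE (pub-ymgap N06 row 13, seat dag-n06-c g5).  `B9Ineq385L2V3` gave the LEFT composite `conj b V₃(A) · G(U)` in block-ℓ²; the right (3.46)-members
of `G(U′U)` (this seat's generic `B9Ineq363L2Right.hasL2Majorant_rightEntry_gpExt`) need the RIGHT composite `G(U)·V(A)`.  For its local third `V₃(A)` the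
route is this seat's ℓ² divergence-form device `B9Ineq363L2Right.hasL2Majorant_GV_of_gradForm_comm_sum_l2` (V = Σ_k∇_kV¹_k + (V⁰ + Σ_k[V¹_k, ∇_k])), whose
one input not yet in the tree in ℓ² is the size of the COMMUTATOR letters `[V¹_k, ∇_k]` — r06 has them in the sup shape (`B9Eq373CurvComm.
hasMajorant_comm_V₃_one`, the curvature lemma) and has their LOCALITY (`B9Ineq385V3RightKernel.loc_V1`, `loc_diffLetter`, `loc_mul`, two-step stencil of
`≦ (2|κ|+1)²` sites).  §1 is the generic passage «sup majorant + locality + multiplicity ⟹ ℓ² majorant»: the column count makes the transpose's sup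
majorant, and p22's Schur test on one block pair (`B6RandomWalkL2Schur.hasL2Majorant_of_hasMajorant_pair`, transpose `B6OpTransposeV1.tr`) gives the
block-ℓ² majorant `√N·K` — an alternative to re-deriving pointwise stencil bounds (cf. `B9Ineq373L2Letters`), usable for every LOCAL letter of the cell.

WHAT IS PROVED (theorems only; 0 sorry; standard axioms; no definition).
* §1 `hasMajorant_tr_of_local` (a sup majorant `K`, entries supported on a stencil of multiplicity `≦ N` ⟹ the transpose `tr T` has the sup majorant
  `N·K(y′,y)`), ★ `hasL2Majorant_of_hasMajorant_local` (⟹ `T ≺₂ √N·K`), ★ `hasL2Majorant_conj_of_hasMajorant_loc` (bond carrier: an `E`-letter local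
  for a symmetric site stencil of `≦ n` sites, `conj b L ≺ K` ⟹ `conj b L ≺₂ √(|κ|·n·#ι)·K`).
* §2 ★ `hasL2Majorant_comm_V₃_one` — the commutators `[V¹_k, ∇_k]` of the concrete `V₃(A)` in block-ℓ²: r06's sup size × `√(|κ|(2|κ|+1)²#ι)`.
* §3 ★★ `ineq385_l2_GV3` — `G · conj b (V₃Op η A) ≺₂ (B₀Λc₁(β)·Θ₃ᴿ)·α₁·e^{−ρd}` with `Θ₃ᴿ` EXPLICIT, from THEOREM 3.3's (3.46)₀ (`G ≺₂ B₀(Lʲη)²e^{−δd}`)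
  and the RIGHT members (3.46)₂ (`G·∇♯_k ≺₂ B₀Lʲη e^{−δd}` per bond difference letter, both orientations — «we may always replace ∇_U by ∇*_U», p. 398)
  at U, the ℓ² letter sizes of `B9Ineq373L2Letters` and §2, and Lemma 2.1 of [4] (inverse-weight transfers at `α`, (2.61) at `β`, (2.54)).
* §4 ★★ `ineq385_l2_DGV3` — the same composite AT THE LETTER ∇ (the factor of the mixed member (3.46)₄ of `G(U′U)`): for any operator `X` with
  `X ≺₂ B₀Lʲη e^{−δd}` and `X·∇♯_l ≺₂ B₀e^{−δd}` (all `l`) — print: `X = ∇_kG(U)`, members (3.46)₁,₄ of Theorem 3.3 at U — `X · conj b (V₃Op η A) ≺₂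
  (B₀Λc₁(β)·Θ₃ᴿ)·α₁·(Lʲη)⁻¹·e^{−ρd}` (device `B9Ineq363L2Mixed.hasL2Majorant_DGV_of_gradForm_comm_sum_l2`).

HONEST SCOPE.  Finite-dimensional bookkeeping over r06's concrete letters; Theorem 3.3 at U is the INPUT; nothing of [B9] is asserted for Bałaban's
propagators; count-neutral; NOT a node discharge; nothing continuum ∕ OS ∕ mass-gap ∕ Clay.  Cell `pub-ymgap` (HUMAN RULING D-0062), Track A node N06 [B9],
N06-ASSIGNMENT row 13, seat `pub-ymgap-dag-n06-c` (g5), 2026-08-27.  NOT HERE: the `P₂(A)` ∕ `P₁(A)` thirds of (3.85)₂ and the assembly (design memo of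
the seat, `GSIDE-L2-SPEC.md`).
-/

noncomputable section

open scoped BigOperators

namespace Literature.MathematicalPhysics.QuantumFieldTheory.Balaban1983to89.B9Ineq385L2V3Right

open NormedSpace Complex
open Literature.MathematicalPhysics.QuantumFieldTheory.Balaban1983to89
open Literature.MathematicalPhysics.QuantumFieldTheory.Balaban1983to89.B6RandomWalk (HasMajorant BlockSupp Triangle254 Ineq261)
open Literature.MathematicalPhysics.QuantumFieldTheory.Balaban1983to89.B6RandomWalkL2 (HasL2Majorant hasL2Majorant_mono)
open Literature.MathematicalPhysics.QuantumFieldTheory.Balaban1983to89.B6RandomWalkL2Schur (hasL2Majorant_of_hasMajorant_pair)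
open Literature.MathematicalPhysics.QuantumFieldTheory.Balaban1983to89.B6OpTransposeV1 (tr tr_apply_single)
open Literature.MathematicalPhysics.QuantumFieldTheory.Balaban1983to89.B9Thm34Ext (toB6)
open Literature.MathematicalPhysics.QuantumFieldTheory.Balaban1983to89.B9Ineq347 (ScaleTransfer)
open Literature.MathematicalPhysics.QuantumFieldTheory.Balaban1983to89.B9Eq39Adjoint
open Literature.MathematicalPhysics.QuantumFieldTheory.Balaban1983to89.B9Eq369Small
open Literature.MathematicalPhysics.QuantumFieldTheory.Balaban1983to89.B9Eq372Locality (stBonds)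
open Literature.MathematicalPhysics.QuantumFieldTheory.Balaban1983to89.B9Eq375Locality (locBondsA locBondsA')
open Literature.MathematicalPhysics.QuantumFieldTheory.Balaban1983to89.B9Eq373V3 (kΔ)
open Literature.MathematicalPhysics.QuantumFieldTheory.Balaban1983to89.B9Eq352DivForm (tauF tauB)
open Literature.MathematicalPhysics.QuantumFieldTheory.Balaban1983to89.B9Eq352DivFormLetters (conj coordEquiv conj_apply conj_mul conj_sub)
open Literature.MathematicalPhysics.QuantumFieldTheory.Balaban1983to89.B9Eq352GradLetters (diffLetter conj_add)
open Literature.MathematicalPhysics.QuantumFieldTheory.Balaban1983to89.B9Eq371GradLetters (bT bU V1Letter)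
open Literature.MathematicalPhysics.QuantumFieldTheory.Balaban1983to89.B9Eq375GradLetters (V1Letter₂)
open Literature.MathematicalPhysics.QuantumFieldTheory.Balaban1983to89.B9Eq382V3Letters (V₃Op cV0 conj_V₃Op_eq_gradForm)
open Literature.MathematicalPhysics.QuantumFieldTheory.Balaban1983to89.B9Eq373CurvComm (hasMajorant_comm_V₃_one)
open Literature.MathematicalPhysics.QuantumFieldTheory.Balaban1983to89.B9Ineq385V3RightKernel (nbhd₁_mem_self nbhd₁_mem_fwd nbhd₁_mem_bwd
  nbhd₂_comp nbhd₂_symm nbhd₂_card loc_V1 loc_diffLetter loc_mul loc_mono)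
open Literature.MathematicalPhysics.QuantumFieldTheory.Balaban1983to89.B9Ineq346L2RightDiff (coordSymm_single)
open Literature.MathematicalPhysics.QuantumFieldTheory.Balaban1983to89.B9Ineq363L2Right (hasL2Majorant_GV_of_gradForm_comm_sum_l2)
open Literature.MathematicalPhysics.QuantumFieldTheory.Balaban1983to89.B9Ineq363L2Mixed (hasL2Majorant_DGV_of_gradForm_comm_sum_l2)
open Literature.MathematicalPhysics.QuantumFieldTheory.Balaban1983to89.B9Ineq373L2Letters (hasL2Majorant_V₃_one hasL2Majorant_V₃_zero)

/-! ## §1  The bridge: a sup block majorant of a LOCAL operator is a block-ℓ² majorant (Schur test with the transpose) -/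

section Bridge

variable {G₆ : B6.Geometry} [DecidableEq G₆.Site] {X : Type} [Fintype X] [DecidableEq X]

/-- **THE TRANSPOSE OF A LOCAL OPERATOR WITH A SUP MAJORANT HAS A SUP MAJORANT** ([4] (2.51) read column-wise): if `T ≺ K` (`K ≧ 0`), the entry
`T_{x x′} = (Tδ_{x′})(x)` vanishes unless `near x x′`, and every `x′` is `near` to at most `N` points `x`, then `tr T ≺ N·K(y′,y)` — each entry of `T`
is `≦ K` (test function `δ_{x′}`) and a column meets at most `N` rows.
[cite: Balaban1984PropagatorsII, (2.51)–(2.52) p.232 + (2.69) p.235; derivation ours] -/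
theorem hasMajorant_tr_of_local (blk : X → G₆.Site) {T : Module.End ℝ (X → ℝ)} {K : G₆.Site → G₆.Site → ℝ}
    (near : X → X → Prop) (N : ℕ) (hT : HasMajorant blk T K) (hK : ∀ y y', 0 ≤ K y y')
    (hloc : ∀ x x', T (Pi.single x' 1) x ≠ 0 → near x x')
    (hmult : ∀ x', ∃ s : Finset X, (s.card : ℝ) ≤ N ∧ ∀ x, near x x' → x ∈ s) :
    HasMajorant blk (tr T) (fun y y' => N * K y' y) := by
  classical
  intro y' μ B hμ x
  have hB : 0 ≤ B := hμ.nonneg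
  obtain ⟨s, hs, hcov⟩ := hmult x
  -- every entry of the column `x` is `≦ K(y″, y_x)` (test function `δ_x`)
  have hδ : BlockSupp blk (Pi.single x (1 : ℝ)) (blk x) 1 := by
    refine ⟨zero_le_one, fun z _ => ?_, fun z hz => ?_⟩
    · by_cases h : z = x
      · subst h; simp
      · rw [Pi.single_eq_of_ne h]; simp
    · have h : z ≠ x := fun e => hz (by rw [e])
      exact Pi.single_eq_of_ne h _
  have hent : ∀ z : X, |T (Pi.single x 1) z| ≤ K (blk z) (blk x) := fun z => by
    simpa using hT (blk x) (Pi.single x 1) 1 hδ z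
  -- the terms of the dot product
  have hterm : ∀ z : X, |T (Pi.single x 1) z * μ z| ≤ K y' (blk x) * B := by
    intro z
    by_cases hz : blk z = y'
    · rw [abs_mul, ← hz]
      exact mul_le_mul (hent z) (hμ.bound z hz) (abs_nonneg _) (hK _ _)
    · rw [hμ.off z hz, mul_zero, abs_zero]
      exact mul_nonneg (hK _ _) hB
  -- terms off the covering finset vanish
  have hvan : ∀ z : X, z ∉ s → T (Pi.single x 1) z * μ z = 0 := by
    intro z hz
    have : T (Pi.single x 1) z = 0 := by
      by_contra h
      exact hz (hcov z (hloc z x h))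
    rw [this, zero_mul]
  rw [tr_apply_single]
  calc |dotProduct (T (Pi.single x 1)) μ|
      = |∑ z, T (Pi.single x 1) z * μ z| := rfl
    _ = |∑ z ∈ s, T (Pi.single x 1) z * μ z| := by
        rw [← Finset.sum_subset (Finset.subset_univ s) fun z _ hz => hvan z hz]
    _ ≤ ∑ z ∈ s, |T (Pi.single x 1) z * μ z| := Finset.abs_sum_le_sum_abs _ _
    _ ≤ ∑ _z ∈ s, K y' (blk x) * B := Finset.sum_le_sum fun z _ => hterm z
    _ = s.card * (K y' (blk x) * B) := by rw [Finset.sum_const, nsmul_eq_mul]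
    _ ≤ N * (K y' (blk x) * B) := mul_le_mul_of_nonneg_right hs (mul_nonneg (hK _ _) hB)
    _ = N * K y' (blk x) * B := by ring

/-- ★ **SUP MAJORANT + LOCALITY + MULTIPLICITY ⟹ BLOCK-ℓ² MAJORANT** (Schur test on the block pair `Δ(y) × Δ(y′)`, [4] (2.140) from (2.51) for a
local operator): under the hypotheses of `hasMajorant_tr_of_local`, `T ≺₂ √N·K`.
[cite: Balaban1984PropagatorsII, (2.51) p.232 + Prop. 2.6 (2.140) p.247; derivation ours (Schur test via `B6RandomWalkL2Schur`)] -/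
theorem hasL2Majorant_of_hasMajorant_local (blk : X → G₆.Site) {T : Module.End ℝ (X → ℝ)} {K : G₆.Site → G₆.Site → ℝ}
    (near : X → X → Prop) (N : ℕ) (hT : HasMajorant blk T K) (hK : ∀ y y', 0 ≤ K y y')
    (hloc : ∀ x x', T (Pi.single x' 1) x ≠ 0 → near x x')
    (hmult : ∀ x', ∃ s : Finset X, (s.card : ℝ) ≤ N ∧ ∀ x, near x x' → x ∈ s) :
    HasL2Majorant blk T (fun y y' => Real.sqrt N * K y y') := by
  have hN : (0 : ℝ) ≤ N := Nat.cast_nonneg _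
  have hT' := hasMajorant_tr_of_local blk near N hT hK hloc hmult
  have htr : ∀ x x', tr T (Pi.single x 1) x' = T (Pi.single x' 1) x := fun x x' => by
    rw [tr_apply_single]
    simp [dotProduct, Pi.single_apply]
  have h := hasL2Majorant_of_hasMajorant_pair blk hT hT' hK (fun y y' => mul_nonneg hN (hK _ _)) htr
  refine hasL2Majorant_mono blk h fun y y' => le_of_eq ?_
  have h0 : 0 ≤ Real.sqrt N * K y y' := mul_nonneg (Real.sqrt_nonneg _) (hK _ _)
  rw [show K y y' * (N * K y y') = (Real.sqrt N * K y y') ^ 2 by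
    rw [mul_pow, Real.sq_sqrt hN]; ring]
  exact Real.sqrt_sq h0

end Bridge

section ConjBridge

variable {E : Type*} [NormedAddCommGroup E] [NormedSpace ℝ E] {ι : Type} [Fintype ι] [DecidableEq ι] (b : Module.Basis ι ℝ E)
variable {S : Type} [Fintype S] [DecidableEq S] {κ : Type} [Fintype κ] [DecidableEq κ]
variable {g : B9.Geometry} [Fintype g.Site] {Rr : ℝ} {H : Prop}

/-- ★ **THE BRIDGE FOR A CONJUGATED LOCAL LETTER ON THE BOND CARRIER**: an `E`-valued letter `L` LOCAL for a symmetric site stencil `N` of `≦ n`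
sites («(LF)(b) = 0 whenever F vanishes on the bonds over N(x_b)»), with `conj b L ≺ K` (`K ≧ 0`), has `conj b L ≺₂ √(|κ|·n·#ι)·K` — the entries of a
column of `conj b L` live on the bonds over `N(x_{z′})` (r06's `col_conj_of_hasMajorant_local` counting), then §1.
[cite: Balaban1984PropagatorsII, (2.51)–(2.52) p.232 + Prop. 2.6 (2.140) p.247; Balaban1985BackgroundPropagators, p.407 «local … operator»; derivation ours] -/
theorem hasL2Majorant_conj_of_hasMajorant_loc (blk : S → g.Site) (N : S → Finset S) (n : ℕ)
    (hsymm : ∀ z z' : S, z' ∈ N z → z ∈ N z') (hcard : ∀ z, (N z).card ≤ n)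
    (L : Module.End ℝ (κ × S → E))
    (hloc : ∀ (F : κ × S → E) (q : κ × S), (∀ q' : κ × S, q'.2 ∈ N q.2 → F q' = 0) → L F q = 0)
    {K : g.Site → g.Site → ℝ} (hK0 : ∀ a a', 0 ≤ K a a')
    (hK : HasMajorant (g := toB6 g Rr H) (fun z : (κ × S) × ι => blk z.1.2) (conj b L) K) :
    HasL2Majorant (g := toB6 g Rr H) (fun z : (κ × S) × ι => blk z.1.2) (conj b L)
      (fun y y' => Real.sqrt ((Fintype.card κ * n * Fintype.card ι : ℕ) : ℝ) * K y y') := by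
  classical
  refine hasL2Majorant_of_hasMajorant_local (G₆ := toB6 g Rr H) (fun z : (κ × S) × ι => blk z.1.2)
    (fun z z' : (κ × S) × ι => z'.1.2 ∈ N z.1.2) _ hK hK0 ?_ ?_
  · -- locality at the real-coordinate level: the entry `(z, z′)` vanishes unless `x_{z′} ∈ N(x_z)`
    rintro ⟨q, j⟩ ⟨q', i⟩ h
    by_contra hz
    apply h
    rw [conj_apply, coordSymm_single]
    have h0 : L (Pi.single q' (b i)) q = 0 := by
      refine hloc _ q fun q'' hq'' => ?_
      have hne : q'' ≠ q' := by
        rintro rfl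
        exact hz hq''
      exact Pi.single_eq_of_ne hne _
    rw [h0, map_zero, Finsupp.zero_apply]
  · -- multiplicity: the bonds over `N(x_{z′})` times the coordinates
    rintro ⟨q', i⟩
    refine ⟨((Finset.univ : Finset κ) ×ˢ N q'.2) ×ˢ (Finset.univ : Finset ι), ?_, ?_⟩
    · rw [Finset.card_product, Finset.card_product, Finset.card_univ, Finset.card_univ]
      have h1 : Fintype.card κ * (N q'.2).card * Fintype.card ι ≤ Fintype.card κ * n * Fintype.card ι :=
        Nat.mul_le_mul_right _ (Nat.mul_le_mul_left _ (hcard q'.2))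
      exact_mod_cast h1
    · rintro ⟨q, j⟩ hq
      exact Finset.mem_product.2 ⟨Finset.mem_product.2 ⟨Finset.mem_univ _, hsymm _ _ hq⟩, Finset.mem_univ _⟩

end ConjBridge

/-! ## §2  The commutator letters `[V¹_k, ∇_k]` of the concrete `V₃(A)` in block-ℓ² form -/

section Comm

variable {𝔸 : Type*} [NormedRing 𝔸] [NormedAlgebra ℂ 𝔸] [CompleteSpace 𝔸] {ι : Type} [Fintype ι] [DecidableEq ι]
variable (b : Module.Basis ι ℝ 𝔸) {S : Type} [Fintype S] [DecidableEq S] {κ : Type} [Fintype κ] [LinearOrder κ]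
variable (T : κ → Equiv.Perm S) (U : κ → S → 𝔸ˣ)
variable {g : B9.Geometry} [Fintype g.Site] {Rr : ℝ} {H : Prop}

omit [CompleteSpace 𝔸] in
/-- ★ **THE COMMUTATORS `[V¹_k, ∇_k]` OF THE CONCRETE `V₃(A)` IN ℓ²** (r06's curvature sizes `B9Eq373CurvComm.hasMajorant_comm_V₃_one` through §1 with
r06's locality `loc_V1`∕`loc_diffLetter`∕`loc_mul` on the two-step stencil, `≦ (2|κ|+1)²` sites): for every `k ∈ κ ⊕ κ`,
`V¹_k∇_k − ∇_kV¹_k ≺₂ √(|κ|(2|κ|+1)²#ι)·(10 + 8d + (16d+12)C₀)M₂(Σ‖b_i‖)e^{δd₀}·α₁(Lʲη)⁻²·e^{−δd}`, hypotheses = r06's verbatim.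
[cite: Balaban1985BackgroundPropagators, (3.73) p.405 + (3.82)/(3.85) p.407 + (3.71) pp.404–405 + (3.75) p.405 + (3.35)/(3.37) p.396; Balaban1984PropagatorsII, (2.51) p.232 + Prop. 2.6 (2.140) p.247; derivation ours] -/
theorem hasL2Majorant_comm_V₃_one (blk : S → g.Site) (hη : 0 < g.eta) (hL : 1 ≤ g.L) (A : κ → S → 𝔸) (C₀ d₀ δ M₂ α₁ : ℝ)
    (hα₁ : 0 ≤ α₁) (hC₀ : 0 ≤ C₀) (hδ : 0 ≤ δ) (hM₂ : 0 ≤ M₂) (hrepr : ∀ (v : 𝔸) (i : ι), |b.repr v i| ≤ M₂ * ‖v‖)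
    (hT : ∀ (μ ν : κ) (x : S), T μ (T ν x) = T ν (T μ x))
    (hU1 : ∀ μ x, ‖((U μ x : 𝔸ˣ) : 𝔸)‖ ≤ 1 ∧ ‖(((U μ x)⁻¹ : 𝔸ˣ) : 𝔸)‖ ≤ 1)
    (hA : ∀ k x, ‖A k x‖ ≤ α₁ * (g.len (blk x))⁻¹)
    (hAτB : ∀ ν k x, ‖tauB T U ν (A k) x‖ ≤ α₁ * (g.len (blk x))⁻¹)
    (hAτF : ∀ μ k x, ‖tauF T U μ (A k) x‖ ≤ α₁ * (g.len (blk x))⁻¹)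
    (hAFB : ∀ k μ ν x, ‖A k ((T ν).symm (T μ x))‖ ≤ α₁ * (g.len (blk x))⁻¹)
    (h337F : ∀ μ ν x, ‖((g.eta : ℂ)⁻¹) • covD T U μ (A ν) x‖ ≤ α₁ * (g.len (blk x) ^ 2)⁻¹)
    (h337B : ∀ ν k x, ‖((g.eta : ℂ)⁻¹) • covDstar T U ν (A k) x‖ ≤ α₁ * (g.len (blk x) ^ 2)⁻¹)
    (h337B' : ∀ μ ν x, ‖((g.eta : ℂ)⁻¹) • covDstar T U ν (A ν) (T μ x)‖ ≤ α₁ * (g.len (blk x) ^ 2)⁻¹)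
    (h337Bτ : ∀ μ x, ‖((g.eta : ℂ)⁻¹) • covDstar T U μ (tauB T U μ (A μ)) x‖ ≤ α₁ * (g.len (blk x) ^ 2)⁻¹)
    (h337FB : ∀ μ ν k x, ‖((g.eta : ℂ)⁻¹) • covD T U μ (A k) ((T ν).symm x)‖ ≤ α₁ * (g.len (blk x) ^ 2)⁻¹)
    (h35 : ∀ m n x, ‖(plaqU T U m n ((T n).symm x) : 𝔸) - 1‖ ≤ C₀ * ((g.L ^ g.scale (blk x))⁻¹) ^ 2)
    (hd₀B : ∀ μ x, g.dist (blk x) (blk ((T μ).symm x)) ≤ d₀) (hd₀F : ∀ μ x, g.dist (blk x) (blk (T μ x)) ≤ d₀)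
    (hd₀FB : ∀ μ ν x, g.dist (blk x) (blk ((T ν).symm (T μ x))) ≤ d₀) (k : κ ⊕ κ) :
    HasL2Majorant (g := toB6 g Rr H) (fun q : (κ × S) × ι => blk q.1.2)
      ((conj b (V1Letter T U A k) + conj b (V1Letter₂ T U A k)) * conj b (diffLetter (bT T) (bU U) ((g.eta : ℂ)⁻¹) k)
        - conj b (diffLetter (bT T) (bU U) ((g.eta : ℂ)⁻¹) k) * (conj b (V1Letter T U A k) + conj b (V1Letter₂ T U A k)))
      (fun y y' => (Real.sqrt (((Fintype.card κ * (2 * Fintype.card κ + 1) ^ 2 * Fintype.card ι : ℕ) : ℝ)) *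
          ((10 + 8 * Fintype.card κ + (16 * Fintype.card κ + 12) * C₀) * M₂ * (∑ i, ‖b i‖) * Real.exp (δ * d₀))) *
        α₁ * (g.len y ^ 2)⁻¹ * Real.exp (-(δ * g.dist y y'))) := by
  classical
  -- r06's sup size, read on the conjugate of ONE E-valued letter
  set Lc : Module.End ℝ (κ × S → 𝔸) := (V1Letter T U A k + V1Letter₂ T U A k) * diffLetter (bT T) (bU U) ((g.eta : ℂ)⁻¹) k
    - diffLetter (bT T) (bU U) ((g.eta : ℂ)⁻¹) k * (V1Letter T U A k + V1Letter₂ T U A k) with hLc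
  have hconj : conj b Lc = (conj b (V1Letter T U A k) + conj b (V1Letter₂ T U A k)) * conj b (diffLetter (bT T) (bU U) ((g.eta : ℂ)⁻¹) k)
      - conj b (diffLetter (bT T) (bU U) ((g.eta : ℂ)⁻¹) k) * (conj b (V1Letter T U A k) + conj b (V1Letter₂ T U A k)) := by
    rw [hLc, conj_sub, B9Eq352DivFormLetters.conj_mul, B9Eq352DivFormLetters.conj_mul, conj_add]
  have hsup := hasMajorant_comm_V₃_one (Rr := Rr) (H := H) b T U blk hη hL A C₀ d₀ δ M₂ α₁ hα₁ hC₀ hδ hM₂ hrepr hT hU1 hA hAτB hAτF hAFB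
    h337F h337B h337B' h337Bτ h337FB h35 hd₀B hd₀F hd₀FB k
  rw [← hconj] at hsup ⊢
  -- the two-step translation stencil and the locality of the commutator
  set N₁ : S → Finset S := fun z => insert z (Finset.univ.image (fun a => T a z) ∪ Finset.univ.image (fun a => (T a).symm z)) with hN₁
  set N₂ : S → Finset S := fun z => (N₁ z).biUnion N₁ with hN₂
  have hV1 := loc_V1 T U A N₁ (fun z => nbhd₁_mem_self T z) (fun a z => nbhd₁_mem_fwd T a z) (fun a z => nbhd₁_mem_bwd T a z) k
  have hD := loc_diffLetter T U N₁ (fun z => nbhd₁_mem_self T z) (fun a z => nbhd₁_mem_fwd T a z) (fun a z => nbhd₁_mem_bwd T a z)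
    ((g.eta : ℂ)⁻¹) k
  have hN : ∀ z z' z'', z' ∈ N₁ z → z'' ∈ N₁ z' → z'' ∈ N₂ z := fun z z' z'' h₁ h₂ => nbhd₂_comp T z z' z'' h₁ h₂
  have hloc : ∀ (F : κ × S → 𝔸) (q : κ × S), (∀ q' : κ × S, q'.2 ∈ N₂ q.2 → F q' = 0) → Lc F q = 0 := by
    intro F q hF
    rw [hLc, LinearMap.sub_apply, Pi.sub_apply, loc_mul hN hV1 hD F q hF, loc_mul hN hD hV1 F q hF, sub_zero]
  have h := hasL2Majorant_conj_of_hasMajorant_loc (Rr := Rr) (H := H) b blk N₂ ((2 * Fintype.card κ + 1) ^ 2)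
    (fun z z'' hz => nbhd₂_symm T z z'' hz) (fun z => nbhd₂_card T z) Lc hloc (fun a a' => by positivity) hsup
  exact hasL2Majorant_mono (g := toB6 g Rr H) _ h fun y y' => le_of_eq (by ring)

end Comm

/-! ## §3  `G(U)·V₃(A)` in block-ℓ² form -/

section GV

variable {𝔸 : Type*} [NormedRing 𝔸] [NormedAlgebra ℂ 𝔸] [CompleteSpace 𝔸] {ι : Type} [Fintype ι] [DecidableEq ι]
variable (b : Module.Basis ι ℝ 𝔸) {S : Type} [Fintype S] [DecidableEq S] {κ : Type} [Fintype κ] [LinearOrder κ]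
variable (T : κ → Equiv.Perm S) (U : κ → S → 𝔸ˣ)
variable {g : B9.Geometry} [Fintype g.Site] {Rr : ℝ} {H : Prop}

/-- ★★ **(3.85) IN THE BLOCK-`ℓ²` FORM, THE `V₃(A)` THIRD ON THE RIGHT**: `G(U)·conj b V₃(A) ≺₂ (B₀Λc₁(β)·Θ₃ᴿ)·α₁·e^{−ρd}` with
`Θ₃ᴿ = 2d·c₁ᴸ + (c⁰ᴸ + 2d·c_Kᴸ)` EXPLICIT (`c₁ᴸ = 14(d+1)M₂(Σ‖b_i‖)√(N#ι)e^{δd₀}`, `c⁰ᴸ = c⁰_V(d,α₁,C₀)M₂(Σ‖b_i‖)√(N#ι)e^{δd₀}`,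
`c_Kᴸ = √(d(2d+1)²#ι)(10 + 8d + (16d+12)C₀)M₂(Σ‖b_i‖)e^{δd₀}`, `N = d(1+2d+2d²)`).  INPUTS: commuting shifts, a group-valued background, (3.35) on the
plaquettes through ∕ adjacent to each bond at the bond's block scale, (3.37) read blockwise for the letters of `V₃(A)` (as r06 reads it, both for the
sizes and for the commutators), `η·α₁(Lʲη)⁻¹ ≦ 1/4`, stencil geometry, `M₂`; THEOREM 3.3 FOR `G(U)` IN ITS `L²` FORM: (3.46)₀ `G ≺₂ B₀(Lʲη)²e^{−δd}` and
(3.46)₂ `G·∇♯_k ≺₂ B₀Lʲη e^{−δd}` for each bond difference letter; Lemma 2.1 of [4] (transfers of `(Lʲη)⁻¹`, `(Lʲη)⁻²` at `α`, (2.61) at `β`, (2.54));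
`ρ ≧ 0`, `ρ + (α+β)δ₀ ≦ δ`.  Device: `B9Ineq363L2Right.hasL2Majorant_GV_of_gradForm_comm_sum_l2` on `conj_V₃Op_eq_gradForm`.
[cite: Balaban1985BackgroundPropagators, (3.82)–(3.86) p.407 + (3.73) p.405 + Thm 3.3 p.399 + (3.46) p.398 + p.398 (remarks) + p.403 l.5–9; Balaban1984PropagatorsII, Lemma 2.1 p.234 + Prop. 2.6 (2.140)–(2.141) p.247] -/
theorem ineq385_l2_GV3 (blk : S → g.Site) (d : ℕ) (hη : 0 < g.eta) (hL : 1 ≤ g.L) (A : κ → S → 𝔸) (C₀ d₀ M₂ : ℝ)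
    (δ₀ δ α β ρ Λ B₀ α₁ : ℝ)
    (hB₀ : 0 ≤ B₀) (hα₁ : 0 ≤ α₁) (hΛ : 0 ≤ Λ) (hρ : 0 ≤ ρ) (hα : 0 ≤ α) (hβ : 0 ≤ β) (hδ₀ : 0 ≤ δ₀) (hδ : 0 ≤ δ)
    (hr : ρ + (α + β) * δ₀ ≤ δ) (hC₀ : 0 ≤ C₀) (hM₂ : 0 ≤ M₂) (hrepr : ∀ (v : 𝔸) (i : ι), |b.repr v i| ≤ M₂ * ‖v‖)
    (hdnn : ∀ a a' : g.Site, 0 ≤ g.dist a a') (htri : Triangle254 (toB6 g Rr H)) (hlen : ∀ y : g.Site, 0 < g.len y)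
    (h261 : Ineq261 d (toB6 g Rr H) δ₀ β)
    (hT1i : ScaleTransfer g δ₀ α Λ (fun a => (g.len a)⁻¹)) (hT2i : ScaleTransfer g δ₀ α Λ (fun a => (g.len a ^ 2)⁻¹))
    (hsmall : ∀ y : g.Site, g.eta * (α₁ * (g.len y)⁻¹) ≤ 1 / 4)
    (hT : ∀ (μ ν : κ) (x : S), T μ (T ν x) = T ν (T μ x))
    (hU1 : ∀ m z, ‖((U m z : 𝔸ˣ) : 𝔸)‖ ≤ 1 ∧ ‖(((U m z)⁻¹ : 𝔸ˣ) : 𝔸)‖ ≤ 1)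
    -- (3.37) for the exponent field, blockwise
    (hA : ∀ k x, ‖A k x‖ ≤ α₁ * (g.len (blk x))⁻¹) (hAτB : ∀ ν k x, ‖tauB T U ν (A k) x‖ ≤ α₁ * (g.len (blk x))⁻¹)
    (hAτF : ∀ μ k x, ‖tauF T U μ (A k) x‖ ≤ α₁ * (g.len (blk x))⁻¹)
    (hAFB : ∀ k μ ν x, ‖A k ((T ν).symm (T μ x))‖ ≤ α₁ * (g.len (blk x))⁻¹)
    (h337B : ∀ ν k x, ‖((g.eta : ℂ)⁻¹) • covDstar T U ν (A k) x‖ ≤ α₁ * (g.len (blk x) ^ 2)⁻¹)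
    (h337F : ∀ μ ν x, ‖((g.eta : ℂ)⁻¹) • covD T U μ (A ν) x‖ ≤ α₁ * (g.len (blk x) ^ 2)⁻¹)
    (h337B' : ∀ μ ν x, ‖((g.eta : ℂ)⁻¹) • covDstar T U ν (A ν) (T μ x)‖ ≤ α₁ * (g.len (blk x) ^ 2)⁻¹)
    (h337Bτ : ∀ μ x, ‖((g.eta : ℂ)⁻¹) • covDstar T U μ (tauB T U μ (A μ)) x‖ ≤ α₁ * (g.len (blk x) ^ 2)⁻¹)
    (h337FB : ∀ μ ν k x, ‖((g.eta : ℂ)⁻¹) • covD T U μ (A k) ((T ν).symm x)‖ ≤ α₁ * (g.len (blk x) ^ 2)⁻¹)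
    (hAst : ∀ μ x m z, (m, z) ∈ stBonds T μ x → ‖A m z‖ ≤ α₁ * (g.len (blk x))⁻¹)
    (hAloc : ∀ μ x m z, (m, z) ∈ locBondsA T μ x → ‖A m z‖ ≤ α₁ * (g.len (blk x))⁻¹)
    (hdAst : ∀ μ x m n y, Through T μ x m n y →
      ‖covD T U m (A n) y‖ ≤ g.eta * (α₁ * ((g.len (blk x))⁻¹) ^ 2) ∧
        ‖covD T U n (A m) y‖ ≤ g.eta * (α₁ * ((g.len (blk x))⁻¹) ^ 2))
    -- (3.35) on the plaquettes through and adjacent to the output bond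
    (h35 : ∀ μ x m n y, Through T μ x m n y → ‖(plaqU T U m n y : 𝔸) - 1‖ ≤ C₀ * ((g.L ^ g.scale (blk x))⁻¹) ^ 2)
    (h35' : ∀ m n x, ‖(plaqU T U m n ((T n).symm x) : 𝔸) - 1‖ ≤ C₀ * ((g.L ^ g.scale (blk x))⁻¹) ^ 2)
    -- stencil geometry at range `d₀`
    (hd₀B : ∀ μ x, g.dist (blk x) (blk ((T μ).symm x)) ≤ d₀) (hd₀F : ∀ μ x, g.dist (blk x) (blk (T μ x)) ≤ d₀)
    (hd₀FB : ∀ μ ν x, g.dist (blk x) (blk ((T ν).symm (T μ x))) ≤ d₀)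
    (hd₀st : ∀ μ x (q : κ × S), q ∈ stBonds T μ x → g.dist (blk x) (blk q.2) ≤ d₀)
    (hd₀loc : ∀ μ x (q : κ × S), q ∈ locBondsA' T μ x → g.dist (blk x) (blk q.2) ≤ d₀)
    (hd₀0 : ∀ y : g.Site, g.dist y y ≤ d₀)
    -- THEOREM 3.3 FOR `G(U)` IN ITS `L²` FORM: (3.46)₀ and the right members (3.46)₂ on the bond carrier
    {G : Module.End ℝ ((κ × S) × ι → ℝ)}
    (h346_0 : HasL2Majorant (g := toB6 g Rr H) (fun q : (κ × S) × ι => blk q.1.2) G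
      (fun a a' => B₀ * g.len a ^ 2 * Real.exp (-(δ * g.dist a a'))))
    (h346_2 : ∀ k : κ ⊕ κ, HasL2Majorant (g := toB6 g Rr H) (fun q : (κ × S) × ι => blk q.1.2)
      (G * conj b (diffLetter (bT T) (bU U) ((g.eta : ℂ)⁻¹) k)) (fun a a' => B₀ * g.len a * Real.exp (-(δ * g.dist a a')))) :
    HasL2Majorant (g := toB6 g Rr H) (fun q : (κ × S) × ι => blk q.1.2)
      (G * conj b (V₃Op T U g.eta A))
      (fun a a' => (B₀ * Λ * B6.c1 d δ₀ β *
          (2 * Fintype.card κ * (14 * (Fintype.card κ + 1) * M₂ * (∑ i, ‖b i‖) *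
              Real.sqrt (((Fintype.card κ * (1 + 2 * Fintype.card κ + 2 * Fintype.card κ ^ 2)) * Fintype.card ι : ℕ) : ℝ) *
              Real.exp (δ * d₀)) +
            (cV0 (Fintype.card κ) α₁ C₀ * M₂ * (∑ i, ‖b i‖) *
                Real.sqrt (((Fintype.card κ * (1 + 2 * Fintype.card κ + 2 * Fintype.card κ ^ 2)) * Fintype.card ι : ℕ) : ℝ) *
                Real.exp (δ * d₀) +
              2 * Fintype.card κ * (Real.sqrt (((Fintype.card κ * (2 * Fintype.card κ + 1) ^ 2 * Fintype.card ι : ℕ) : ℝ)) *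
                ((10 + 8 * Fintype.card κ + (16 * Fintype.card κ + 12) * C₀) * M₂ * (∑ i, ‖b i‖) * Real.exp (δ * d₀)))))) *
        α₁ * Real.exp (-(ρ * g.dist a a'))) := by
  have hSb : 0 ≤ ∑ i, ‖b i‖ := Finset.sum_nonneg fun i _ => norm_nonneg _
  have hcV00 : 0 ≤ cV0 (Fintype.card κ) α₁ C₀ := by
    have := B9Eq382V3Operator.kΔ_nonneg hα₁ hC₀
    have := B9Eq372RemLetters.growth_nonneg (s := (1 : ℝ) / 4) (by norm_num)
    unfold cV0; positivity
  set c1L : ℝ := 14 * (Fintype.card κ + 1) * M₂ * (∑ i, ‖b i‖) *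
    Real.sqrt (((Fintype.card κ * (1 + 2 * Fintype.card κ + 2 * Fintype.card κ ^ 2)) * Fintype.card ι : ℕ) : ℝ) * Real.exp (δ * d₀) with hc1L
  set c0L : ℝ := cV0 (Fintype.card κ) α₁ C₀ * M₂ * (∑ i, ‖b i‖) *
    Real.sqrt (((Fintype.card κ * (1 + 2 * Fintype.card κ + 2 * Fintype.card κ ^ 2)) * Fintype.card ι : ℕ) : ℝ) * Real.exp (δ * d₀) with hc0L
  set cKL : ℝ := Real.sqrt (((Fintype.card κ * (2 * Fintype.card κ + 1) ^ 2 * Fintype.card ι : ℕ) : ℝ)) *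
    ((10 + 8 * Fintype.card κ + (16 * Fintype.card κ + 12) * C₀) * M₂ * (∑ i, ‖b i‖) * Real.exp (δ * d₀)) with hcKL
  have hc1L0 : 0 ≤ c1L := by rw [hc1L]; positivity
  have hc0L0 : 0 ≤ c0L := by rw [hc0L]; positivity
  have hcKL0 : 0 ≤ cKL := by rw [hcKL]; positivity
  have h := hasL2Majorant_GV_of_gradForm_comm_sum_l2 (R := Rr) (H := H) (fun q : (κ × S) × ι => blk q.1.2) d
    (Finset.univ : Finset (κ ⊕ κ)) δ₀ δ α β ρ Λ B₀ c0L α₁ (fun _ => c1L) (fun _ => cKL) hB₀ hc0L0 hα₁ hΛ hρ hα hβ hδ₀ hr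
    (fun _ _ => hc1L0) (fun _ _ => hcKL0) hdnn htri hlen h261 hT1i hT2i
    (V1 := fun k => conj b (V1Letter T U A k) + conj b (V1Letter₂ T U A k))
    (D := fun k => conj b (diffLetter (bT T) (bU U) ((g.eta : ℂ)⁻¹) k))
    (conj_V₃Op_eq_gradForm T U b g.eta A)
    (by
      simpa only [hc0L] using hasL2Majorant_V₃_zero (Rr := Rr) (H := H) b T U blk hη hL A C₀ d₀ δ M₂ α₁ hα₁ hC₀ hδ hM₂ hrepr hlen
        hsmall hU1 h337B h337F h337B' hAst hAloc hdAst h35 hd₀B hd₀F hd₀FB hd₀st hd₀loc hd₀0)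
    (fun k _ => by
      simpa only [hc1L] using hasL2Majorant_V₃_one (Rr := Rr) (H := H) b T U blk A d₀ δ M₂ α₁ hα₁ hδ hM₂ hrepr hlen hA hAτB hAτF hU1
        hd₀B hd₀F hd₀0 k)
    (fun k _ => by
      simpa only [hcKL] using hasL2Majorant_comm_V₃_one (Rr := Rr) (H := H) b T U blk hη hL A C₀ d₀ δ M₂ α₁ hα₁ hC₀ hδ hM₂ hrepr hT
        hU1 hA hAτB hAτF hAFB h337F h337B h337B' h337Bτ h337FB h35' hd₀B hd₀F hd₀FB k)
    h346_0 (fun k _ => h346_2 k)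
  refine hasL2Majorant_mono (g := toB6 g Rr H) _ h fun a a' => le_of_eq ?_
  rw [Finset.sum_const, Finset.sum_const, Finset.card_univ, Fintype.card_sum, nsmul_eq_mul, nsmul_eq_mul, Nat.cast_add, hc1L, hc0L, hcKL]
  ring

end GV

/-! ## §4  `∇_kG(U)·V₃(A)` in block-ℓ² form (the mixed member's factor) -/

section DGV

variable {𝔸 : Type*} [NormedRing 𝔸] [NormedAlgebra ℂ 𝔸] [CompleteSpace 𝔸] {ι : Type} [Fintype ι] [DecidableEq ι]
variable (b : Module.Basis ι ℝ 𝔸) {S : Type} [Fintype S] [DecidableEq S] {κ : Type} [Fintype κ] [LinearOrder κ]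
variable (T : κ → Equiv.Perm S) (U : κ → S → 𝔸ˣ)
variable {g : B9.Geometry} [Fintype g.Site] {Rr : ℝ} {H : Prop}

/-- ★★ **THE SAME COMPOSITE AT THE LETTER ∇ — `∇_kG(U)·conj b V₃(A) ≺₂ (B₀Λc₁(β)·Θ₃ᴿ)·α₁·(Lʲη)⁻¹·e^{−ρd}`** (the factor of the MIXED member (3.46)₄ of
`G(U′U)` in `∇G(U′U)∇* = ∇G(U)∇* + (∇G(U)V)·(G(U′U)∇*)`), stated for any operator `X` in the rôle of `∇_kG(U)` with THEOREM 3.3's members (3.46)₁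
(`X ≺₂ B₀Lʲη e^{−δd}`) and (3.46)₄ (`X·∇♯_l ≺₂ B₀e^{−δd}`, all `l`) at U; same letters and
`Θ₃ᴿ = 2d·c₁ᴸ + (c⁰ᴸ + 2d·c_Kᴸ)` EXPLICIT (`c₁ᴸ = 14(d+1)M₂(Σ‖b_i‖)√(N#ι)e^{δd₀}`, `c⁰ᴸ = c⁰_V(d,α₁,C₀)M₂(Σ‖b_i‖)√(N#ι)e^{δd₀}`,
`c_Kᴸ = √(d(2d+1)²#ι)(10 + 8d + (16d+12)C₀)M₂(Σ‖b_i‖)e^{δd₀}`, `N = d(1+2d+2d²)`).  INPUTS: commuting shifts, a group-valued background, (3.35) on the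
plaquettes through ∕ adjacent to each bond at the bond's block scale, (3.37) read blockwise for the letters of `V₃(A)` (as r06 reads it, both for the
sizes and for the commutators), `η·α₁(Lʲη)⁻¹ ≦ 1/4`, stencil geometry, `M₂`; Lemma 2.1 of [4] (transfers of `(Lʲη)⁻¹`, `(Lʲη)⁻²` at `α`, (2.61)
at `β`, (2.54)); `ρ ≧ 0`, `ρ + (α+β)δ₀ ≦ δ`.  Device: `B9Ineq363L2Mixed.hasL2Majorant_DGV_of_gradForm_comm_sum_l2` on `conj_V₃Op_eq_gradForm`.
[cite: Balaban1985BackgroundPropagators, (3.82)–(3.86) p.407 + (3.73) p.405 + Thm 3.3 p.399 + (3.46) p.398 + p.398 (remarks) + p.403 l.1–9; Balaban1984PropagatorsII, Lemma 2.1 p.234 + Prop. 2.6 (2.140)–(2.141) p.247] -/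
theorem ineq385_l2_DGV3 (blk : S → g.Site) (d : ℕ) (hη : 0 < g.eta) (hL : 1 ≤ g.L) (A : κ → S → 𝔸) (C₀ d₀ M₂ : ℝ)
    (δ₀ δ α β ρ Λ B₀ α₁ : ℝ)
    (hB₀ : 0 ≤ B₀) (hα₁ : 0 ≤ α₁) (hΛ : 0 ≤ Λ) (hρ : 0 ≤ ρ) (hα : 0 ≤ α) (hβ : 0 ≤ β) (hδ₀ : 0 ≤ δ₀) (hδ : 0 ≤ δ)
    (hr : ρ + (α + β) * δ₀ ≤ δ) (hC₀ : 0 ≤ C₀) (hM₂ : 0 ≤ M₂) (hrepr : ∀ (v : 𝔸) (i : ι), |b.repr v i| ≤ M₂ * ‖v‖)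
    (hdnn : ∀ a a' : g.Site, 0 ≤ g.dist a a') (htri : Triangle254 (toB6 g Rr H)) (hlen : ∀ y : g.Site, 0 < g.len y)
    (h261 : Ineq261 d (toB6 g Rr H) δ₀ β)
    (hT1i : ScaleTransfer g δ₀ α Λ (fun a => (g.len a)⁻¹)) (hT2i : ScaleTransfer g δ₀ α Λ (fun a => (g.len a ^ 2)⁻¹))
    (hsmall : ∀ y : g.Site, g.eta * (α₁ * (g.len y)⁻¹) ≤ 1 / 4)
    (hT : ∀ (μ ν : κ) (x : S), T μ (T ν x) = T ν (T μ x))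
    (hU1 : ∀ m z, ‖((U m z : 𝔸ˣ) : 𝔸)‖ ≤ 1 ∧ ‖(((U m z)⁻¹ : 𝔸ˣ) : 𝔸)‖ ≤ 1)
    -- (3.37) for the exponent field, blockwise
    (hA : ∀ k x, ‖A k x‖ ≤ α₁ * (g.len (blk x))⁻¹) (hAτB : ∀ ν k x, ‖tauB T U ν (A k) x‖ ≤ α₁ * (g.len (blk x))⁻¹)
    (hAτF : ∀ μ k x, ‖tauF T U μ (A k) x‖ ≤ α₁ * (g.len (blk x))⁻¹)
    (hAFB : ∀ k μ ν x, ‖A k ((T ν).symm (T μ x))‖ ≤ α₁ * (g.len (blk x))⁻¹)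
    (h337B : ∀ ν k x, ‖((g.eta : ℂ)⁻¹) • covDstar T U ν (A k) x‖ ≤ α₁ * (g.len (blk x) ^ 2)⁻¹)
    (h337F : ∀ μ ν x, ‖((g.eta : ℂ)⁻¹) • covD T U μ (A ν) x‖ ≤ α₁ * (g.len (blk x) ^ 2)⁻¹)
    (h337B' : ∀ μ ν x, ‖((g.eta : ℂ)⁻¹) • covDstar T U ν (A ν) (T μ x)‖ ≤ α₁ * (g.len (blk x) ^ 2)⁻¹)
    (h337Bτ : ∀ μ x, ‖((g.eta : ℂ)⁻¹) • covDstar T U μ (tauB T U μ (A μ)) x‖ ≤ α₁ * (g.len (blk x) ^ 2)⁻¹)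
    (h337FB : ∀ μ ν k x, ‖((g.eta : ℂ)⁻¹) • covD T U μ (A k) ((T ν).symm x)‖ ≤ α₁ * (g.len (blk x) ^ 2)⁻¹)
    (hAst : ∀ μ x m z, (m, z) ∈ stBonds T μ x → ‖A m z‖ ≤ α₁ * (g.len (blk x))⁻¹)
    (hAloc : ∀ μ x m z, (m, z) ∈ locBondsA T μ x → ‖A m z‖ ≤ α₁ * (g.len (blk x))⁻¹)
    (hdAst : ∀ μ x m n y, Through T μ x m n y →
      ‖covD T U m (A n) y‖ ≤ g.eta * (α₁ * ((g.len (blk x))⁻¹) ^ 2) ∧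
        ‖covD T U n (A m) y‖ ≤ g.eta * (α₁ * ((g.len (blk x))⁻¹) ^ 2))
    -- (3.35) on the plaquettes through and adjacent to the output bond
    (h35 : ∀ μ x m n y, Through T μ x m n y → ‖(plaqU T U m n y : 𝔸) - 1‖ ≤ C₀ * ((g.L ^ g.scale (blk x))⁻¹) ^ 2)
    (h35' : ∀ m n x, ‖(plaqU T U m n ((T n).symm x) : 𝔸) - 1‖ ≤ C₀ * ((g.L ^ g.scale (blk x))⁻¹) ^ 2)
    -- stencil geometry at range `d₀`
    (hd₀B : ∀ μ x, g.dist (blk x) (blk ((T μ).symm x)) ≤ d₀) (hd₀F : ∀ μ x, g.dist (blk x) (blk (T μ x)) ≤ d₀)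
    (hd₀FB : ∀ μ ν x, g.dist (blk x) (blk ((T ν).symm (T μ x))) ≤ d₀)
    (hd₀st : ∀ μ x (q : κ × S), q ∈ stBonds T μ x → g.dist (blk x) (blk q.2) ≤ d₀)
    (hd₀loc : ∀ μ x (q : κ × S), q ∈ locBondsA' T μ x → g.dist (blk x) (blk q.2) ≤ d₀)
    (hd₀0 : ∀ y : g.Site, g.dist y y ≤ d₀)
    -- THEOREM 3.3 FOR `G(U)` IN ITS `L²` FORM at the letter ∇: (3.46)₁ for `X = ∇_kG(U)` and the mixed members (3.46)₄ `X·∇♯_l`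
    {X : Module.End ℝ ((κ × S) × ι → ℝ)}
    (h346_1 : HasL2Majorant (g := toB6 g Rr H) (fun q : (κ × S) × ι => blk q.1.2) X
      (fun a a' => B₀ * g.len a * Real.exp (-(δ * g.dist a a'))))
    (h346_4 : ∀ l : κ ⊕ κ, HasL2Majorant (g := toB6 g Rr H) (fun q : (κ × S) × ι => blk q.1.2)
      (X * conj b (diffLetter (bT T) (bU U) ((g.eta : ℂ)⁻¹) l)) (fun a a' => B₀ * 1 * Real.exp (-(δ * g.dist a a')))) :
    HasL2Majorant (g := toB6 g Rr H) (fun q : (κ × S) × ι => blk q.1.2)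
      (X * conj b (V₃Op T U g.eta A))
      (fun a a' => (B₀ * Λ * B6.c1 d δ₀ β *
          (2 * Fintype.card κ * (14 * (Fintype.card κ + 1) * M₂ * (∑ i, ‖b i‖) *
              Real.sqrt (((Fintype.card κ * (1 + 2 * Fintype.card κ + 2 * Fintype.card κ ^ 2)) * Fintype.card ι : ℕ) : ℝ) *
              Real.exp (δ * d₀)) +
            (cV0 (Fintype.card κ) α₁ C₀ * M₂ * (∑ i, ‖b i‖) *
                Real.sqrt (((Fintype.card κ * (1 + 2 * Fintype.card κ + 2 * Fintype.card κ ^ 2)) * Fintype.card ι : ℕ) : ℝ) *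
                Real.exp (δ * d₀) +
              2 * Fintype.card κ * (Real.sqrt (((Fintype.card κ * (2 * Fintype.card κ + 1) ^ 2 * Fintype.card ι : ℕ) : ℝ)) *
                ((10 + 8 * Fintype.card κ + (16 * Fintype.card κ + 12) * C₀) * M₂ * (∑ i, ‖b i‖) * Real.exp (δ * d₀)))))) *
        α₁ * (g.len a)⁻¹ * Real.exp (-(ρ * g.dist a a'))) := by
  have hSb : 0 ≤ ∑ i, ‖b i‖ := Finset.sum_nonneg fun i _ => norm_nonneg _
  have hcV00 : 0 ≤ cV0 (Fintype.card κ) α₁ C₀ := by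
    have := B9Eq382V3Operator.kΔ_nonneg hα₁ hC₀
    have := B9Eq372RemLetters.growth_nonneg (s := (1 : ℝ) / 4) (by norm_num)
    unfold cV0; positivity
  set c1L : ℝ := 14 * (Fintype.card κ + 1) * M₂ * (∑ i, ‖b i‖) *
    Real.sqrt (((Fintype.card κ * (1 + 2 * Fintype.card κ + 2 * Fintype.card κ ^ 2)) * Fintype.card ι : ℕ) : ℝ) * Real.exp (δ * d₀) with hc1L
  set c0L : ℝ := cV0 (Fintype.card κ) α₁ C₀ * M₂ * (∑ i, ‖b i‖) *
    Real.sqrt (((Fintype.card κ * (1 + 2 * Fintype.card κ + 2 * Fintype.card κ ^ 2)) * Fintype.card ι : ℕ) : ℝ) * Real.exp (δ * d₀) with hc0L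
  set cKL : ℝ := Real.sqrt (((Fintype.card κ * (2 * Fintype.card κ + 1) ^ 2 * Fintype.card ι : ℕ) : ℝ)) *
    ((10 + 8 * Fintype.card κ + (16 * Fintype.card κ + 12) * C₀) * M₂ * (∑ i, ‖b i‖) * Real.exp (δ * d₀)) with hcKL
  have hc1L0 : 0 ≤ c1L := by rw [hc1L]; positivity
  have hc0L0 : 0 ≤ c0L := by rw [hc0L]; positivity
  have hcKL0 : 0 ≤ cKL := by rw [hcKL]; positivity
  have h := hasL2Majorant_DGV_of_gradForm_comm_sum_l2 (R := Rr) (H := H) (fun q : (κ × S) × ι => blk q.1.2) d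
    (Finset.univ : Finset (κ ⊕ κ)) δ₀ δ α β ρ Λ B₀ c0L α₁ (fun _ => c1L) (fun _ => cKL) hB₀ hc0L0 hα₁ hΛ hρ hα hβ hδ₀ hr
    (fun _ _ => hc1L0) (fun _ _ => hcKL0) hdnn htri hlen h261 hT1i hT2i
    (V1 := fun k => conj b (V1Letter T U A k) + conj b (V1Letter₂ T U A k))
    (D := fun k => conj b (diffLetter (bT T) (bU U) ((g.eta : ℂ)⁻¹) k))
    (conj_V₃Op_eq_gradForm T U b g.eta A)
    (by
      simpa only [hc0L] using hasL2Majorant_V₃_zero (Rr := Rr) (H := H) b T U blk hη hL A C₀ d₀ δ M₂ α₁ hα₁ hC₀ hδ hM₂ hrepr hlen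
        hsmall hU1 h337B h337F h337B' hAst hAloc hdAst h35 hd₀B hd₀F hd₀FB hd₀st hd₀loc hd₀0)
    (fun k _ => by
      simpa only [hc1L] using hasL2Majorant_V₃_one (Rr := Rr) (H := H) b T U blk A d₀ δ M₂ α₁ hα₁ hδ hM₂ hrepr hlen hA hAτB hAτF hU1
        hd₀B hd₀F hd₀0 k)
    (fun k _ => by
      simpa only [hcKL] using hasL2Majorant_comm_V₃_one (Rr := Rr) (H := H) b T U blk hη hL A C₀ d₀ δ M₂ α₁ hα₁ hC₀ hδ hM₂ hrepr hT
        hU1 hA hAτB hAτF hAFB h337F h337B h337B' h337Bτ h337FB h35' hd₀B hd₀F hd₀FB k)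
    h346_1 (fun k _ => h346_4 k)
  refine hasL2Majorant_mono (g := toB6 g Rr H) _ h fun a a' => le_of_eq ?_
  rw [Finset.sum_const, Finset.sum_const, Finset.card_univ, Fintype.card_sum, nsmul_eq_mul, nsmul_eq_mul, Nat.cast_add, hc1L, hc0L, hcKL]
  ring

end DGV

end Literature.MathematicalPhysics.QuantumFieldTheory.Balaban1983to89.B9Ineq385L2V3Right
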